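import Literature.AlgebraicTopology.SingularHomology.TowerMilnorSequence
import Literature.AlgebraicTopology.SingularHomology.CohomologyOpenExhaustion
import Literature.AlgebraicTopology.SingularHomology.RelativeCapProduct
import HarnessLib

/-!
# The Milnor sequence of an increasing open exhaustion

A. Hatcher, *Algebraic Topology* (2002), §3.F Thm. 3F.8 (for CW subcomplexes; here open subsets,
where no telescope is needed): for `X = ⋃ₙ Xₙ` an increasing union of OPEN subsets, the singular
cochain complex of `X` IS the inverse limit of the (epimorphic) tower of cochain complexes of the
`Xₙ` — a cochain is a function on simplices and every simplex lies in some `Xₙ`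
(`CohomologyOpenExhaustion`) — so the algebraic Milnor sequence (`TowerMilnorSequence`) reads

`0 → lim¹ₙ Hᵏ(Xₙ) → Hᵏ⁺¹(X) → limₙ Hᵏ⁺¹(Xₙ) → 0`.

* `exhCx`, `exhρ`, `exhρ_surjective` — the tower `n ↦ C*(Xₙ)` and its surjective restrictions;
* `toLim : C*(X) ⟶ lim C*(Xₙ)` (restrictions), an ISOMORPHISM of complexes (`toLim_bijective`, `toLimIso`);
* `restrictionsLim : Hᵏ(X) → lim Hᵏ(Xₙ)` surjective, `phantomMap : lim¹ Hᵏ(Xₙ) → Hᵏ⁺¹(X)` injective,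
  exact (`restrictionsLim_phantomMap`, `exists_phantomMap_eq`), with the EXPLICIT cochain description
  of `phantomMap` (`phantomMap_mk_eq`): for cocycles `ηₙ` and cochains `θₙ` on `Xₙ` with
  `θₙ - θₙ₊₁| = ηₙ`, the class of `[(ηₙ)]` goes to the class of the global cocycle glued from `(dθₙ)ₙ`.

Everything is proved; no named facts.

## References

* A. Hatcher, *Algebraic Topology*, CUP 2002, §3.F Thm. 3F.8. [HatcherAT2002]
* J. Milnor, *On axiomatic homology theory*, Pacific J. Math. 12 (1962), Lemma 2. [Milnor1962]
-/

noncomputable section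

open CategoryTheory CategoryTheory.Limits Set Function

universe u v

namespace Literature.AlgebraicTopology.SingularHomology


variable (R : Type v) [CommRing R] (M : Type v) [AddCommGroup M] [Module R M]
  {X : Type u} [TopologicalSpace X] {V : ℕ → Set X} (hVo : ∀ n, IsOpen (V n)) (hmono : Monotone V)
  (hV : ⋃ n, V n = univ)

/-! ### The tower of cochain complexes of an exhaustion -/

/-- The tower `n ↦ C*(Xₙ; M)`. [folklore] -/
abbrev exhCx (_hmono : Monotone V) : ℕ → CochainComplex (ModuleCat.{max u v} R) ℕ := fun n ↦ singularCochainComplex R M ↥(V n)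

/-- Its transition maps: restriction along `Xₙ ⊆ Xₙ₊₁`. [folklore] -/
abbrev exhρ : ∀ n, exhCx R M hmono (n + 1) ⟶ exhCx R M hmono n := fun n ↦ resSucc (R := R) (M := M) hmono n

/-- **The restrictions are surjective** (extend by zero). [cite: HatcherAT2002, §3.F Thm. 3F.8 (proof)] -/
theorem exhρ_surjective (n k : ℕ) : Surjective ((exhρ R M hmono n).f k) := fun d ↦
  ⟨extendZero (R := R) (hmono (Nat.le_succ n)) d, map_inclusion_extendZero _ d⟩

/-- **`C*(X) → lim C*(Xₙ)`, `φ ↦ (φ|Xₙ)ₙ`**, a cochain map. [cite: HatcherAT2002, §3.F Thm. 3F.8 (proof)] -/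
def toLim : singularCochainComplex R M X ⟶ limCx (exhCx R M hmono) (exhρ R M hmono) where
  f k := ModuleCat.ofHom
    { toFun := fun φ ↦ ⟨fun n ↦ (singularCochainComplex.map R M (subsetIncl (V n))).f k φ,
        (mem_towerLim_iff (M := XTower (exhCx R M hmono) k) _ _).2 fun n ↦ by
          change (singularCochainComplex.map R M (ContinuousMap.inclusion (hmono (Nat.le_succ n)))).f k
            ((singularCochainComplex.map R M (subsetIncl (V (n + 1)))).f k φ) = _
          rw [← ModuleCat.comp_apply, ← HomologicalComplex.comp_f, ← singularCochainComplex.map_comp]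
          rfl⟩
      map_add' := fun φ ψ ↦ Subtype.ext (funext fun n ↦ map_add _ _ _)
      map_smul' := fun r φ ↦ Subtype.ext (funext fun n ↦ map_smul _ _ _) }
  comm' k l _ := by
    refine ModuleCat.hom_ext (LinearMap.ext fun φ ↦ Subtype.ext (funext fun n ↦ ?_))
    change (singularCochainComplex R M ↥(V n)).d k l ((singularCochainComplex.map R M (subsetIncl (V n))).f k φ) =
      (singularCochainComplex.map R M (subsetIncl (V n))).f l ((singularCochainComplex R M X).d k l φ)
    rw [← ModuleCat.comp_apply, (singularCochainComplex.map R M (subsetIncl (V n))).comm k l, ModuleCat.comp_apply]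

/-- `toLim`, applied. [folklore] -/
@[simp] theorem toLim_f_apply_coe (k : ℕ) (φ : (singularCochainComplex R M X).X k) (n : ℕ) :
    ((toLim R M hmono).f k φ : limX (exhCx R M hmono) (exhρ R M hmono) k).1 n =
      (singularCochainComplex.map R M (subsetIncl (V n))).f k φ := rfl

include hVo hV in
/-- **`toLim` is bijective in each degree**: injective since every simplex lies in some `Xₙ`,
surjective by glueing exactly compatible families. [cite: HatcherAT2002, §3.F Thm. 3F.8 (proof)] -/
theorem toLim_bijective (k : ℕ) : Bijective ((toLim R M hmono).f k) := by
  constructor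
  · intro φ ψ h
    funext σ
    obtain ⟨n, hn⟩ := SingularSimplex.exists_range_subset_of_exhaustion hVo hmono hV σ
    have h1 := congrFun (congrFun (congrArg Subtype.val h) n) (SingularSimplex.codRestrict σ (V n) hn)
    rw [toLim_f_apply_coe, toLim_f_apply_coe, singularCochainComplex.map_apply, singularCochainComplex.map_apply,
      SingularSimplex.codRestrict_map_val] at h1
    exact h1
  · intro ψ
    have hψ : ∀ n, (singularCochainComplex.map R M (ContinuousMap.inclusion (hmono (Nat.le_succ n)))).f k
        (ψ.1 (n + 1)) = ψ.1 n := (mem_towerLim_iff (M := XTower (exhCx R M hmono) k) _ _).1 ψ.2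
    refine ⟨glueSeq (R := R) hVo hmono hV ψ.1, Subtype.ext (funext fun n ↦ ?_)⟩
    rw [toLim_f_apply_coe]
    exact map_subsetIncl_glueSeq hVo hmono hV ψ.1 hψ n

/-- **`C*(X) ≅ lim C*(Xₙ)` as cochain complexes.** [cite: HatcherAT2002, §3.F Thm. 3F.8 (proof)] -/
def toLimIso : singularCochainComplex R M X ≅ limCx (exhCx R M hmono) (exhρ R M hmono) :=
  HomologicalComplex.Hom.isoOfComponents
    (fun k ↦ (LinearEquiv.ofBijective ((toLim R M hmono).f k).hom (toLim_bijective R M hVo hmono hV k)).toModuleIso)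
    fun k l _ ↦ (toLim R M hmono).comm k l

/-- The isomorphism is `toLim`. [folklore] -/
@[simp] theorem toLimIso_hom : (toLimIso R M hVo hmono hV).hom = toLim R M hmono := rfl

include hVo hV in
/-- `Hᵏ(toLim)` is bijective. [folklore] -/
theorem homologyMap_toLim_bijective (k : ℕ) :
    Bijective (HomologicalComplex.homologyMap (toLim R M hmono (V := V)) k) :=
  (ConcreteCategory.isIso_iff_bijective _).1
    (inferInstanceAs (IsIso ((HomologicalComplex.homologyFunctor _ _ k).map (toLimIso R M hVo hmono hV).hom)))

/-! ### The Milnor sequence for `Hᵏ(X)` -/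

/-- The tower of cohomology modules `n ↦ Hᵏ(Xₙ; M)` of the exhaustion. [folklore] -/
abbrev exhH (k : ℕ) : ℕ → Type (max u v) := HTower (exhCx R M hmono) k

/-- Its transition maps (restrictions). [folklore] -/
abbrev exhρH (k : ℕ) : ∀ n, exhH R M hmono k (n + 1) →ₗ[R] exhH R M hmono k n := ρH (exhCx R M hmono) (exhρ R M hmono) k

/-- **`Hᵏ(X) → lim Hᵏ(Xₙ)`, the family of restrictions.** [cite: HatcherAT2002, §3.F Thm. 3F.8] -/
def restrictionsLim (k : ℕ) : singularCohomology R M X k →ₗ[R] towerLim (M := exhH R M hmono k) (exhρH R M hmono k) :=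
  (milnorSurj (exhCx R M hmono) (exhρ R M hmono) k).comp (HomologicalComplex.homologyMap (toLim R M hmono) k).hom

/-- `πₙ ∘ ι ∘ toLim` is the restriction to `Xₙ`. [folklore] -/
theorem toLim_ιMap_piProj (n : ℕ) :
    toLim R M hmono ≫ ιMap (exhCx R M hmono) (exhρ R M hmono) ≫ piProj (exhCx R M hmono) n =
      singularCochainComplex.map R M (subsetIncl (V n)) := by
  ext k φ
  rfl

/-- **The components of `restrictionsLim x` are the restrictions `x|Xₙ`.** [folklore] -/
@[simp] theorem restrictionsLim_apply_coe (k : ℕ) (x : singularCohomology R M X k) (n : ℕ) :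
    (restrictionsLim R M hmono k x).1 n = singularCohomology.map R M (subsetIncl (V n)) k x := by
  change (HomologicalComplex.homologyMap (toLim R M hmono) k ≫ HomologicalComplex.homologyMap (ιMap _ _) k ≫
    HomologicalComplex.homologyMap (piProj (exhCx R M hmono) n) k) x = _
  rw [← HomologicalComplex.homologyMap_comp, ← HomologicalComplex.homologyMap_comp, toLim_ιMap_piProj]
  rfl

include hVo hV in
/-- **`Hᵏ(X) → lim Hᵏ(Xₙ)` is surjective.** [cite: HatcherAT2002, §3.F Thm. 3F.8] -/
theorem restrictionsLim_surjective (k : ℕ) : Surjective (restrictionsLim R M hmono k (V := V)) :=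
  (milnorSurj_surjective _ _ (exhρ_surjective R M hmono) k).comp (homologyMap_toLim_bijective R M hVo hmono hV k).2


/-- **`lim¹ Hᵏ(Xₙ) → Hᵏ⁺¹(X)`, the phantom classes** (classes invisible on every `Xₙ`).
[cite: HatcherAT2002, §3.F Thm. 3F.8] -/
def phantomMap (k : ℕ) :
    towerLim1 (M := exhH R M hmono k) (exhρH R M hmono k) →ₗ[R] singularCohomology R M X (k + 1) :=
  (HomologicalComplex.homologyMap (toLimIso R M hVo hmono hV).inv (k + 1)).hom.comp
    (milnorInj (exhCx R M hmono) (exhρ R M hmono) (exhρ_surjective R M hmono) k)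

/-- The phantom map, unfolded. [folklore] -/
theorem phantomMap_apply (k : ℕ) (q : towerLim1 (M := exhH R M hmono k) (exhρH R M hmono k)) :
    phantomMap R M hVo hmono hV k q = HomologicalComplex.homologyMap (toLimIso R M hVo hmono hV).inv (k + 1)
      (milnorInj (exhCx R M hmono) (exhρ R M hmono) (exhρ_surjective R M hmono) k q) := rfl

/-- `H(toLim) ∘ H(toLim⁻¹) = id`, applied. [folklore] -/
theorem homologyMap_toLim_inv (k : ℕ) (y : (limCx (exhCx R M hmono) (exhρ R M hmono)).homology k) :
    HomologicalComplex.homologyMap (toLim R M hmono) k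
      (HomologicalComplex.homologyMap (toLimIso R M hVo hmono hV).inv k y) = y := by
  rw [← ModuleCat.comp_apply, ← HomologicalComplex.homologyMap_comp, ← toLimIso_hom R M hVo hmono hV, Iso.inv_hom_id,
    HomologicalComplex.homologyMap_id]
  rfl

/-- `H(toLim⁻¹) ∘ H(toLim) = id`, applied. [folklore] -/
theorem homologyMap_inv_toLim (k : ℕ) (x : singularCohomology R M X k) :
    HomologicalComplex.homologyMap (toLimIso R M hVo hmono hV).inv k
      (HomologicalComplex.homologyMap (toLim R M hmono) k x) = x := by
  change (HomologicalComplex.homologyMap (toLimIso R M hVo hmono hV).hom k ≫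
    HomologicalComplex.homologyMap (toLimIso R M hVo hmono hV).inv k) x = x
  rw [← HomologicalComplex.homologyMap_comp, Iso.hom_inv_id, HomologicalComplex.homologyMap_id]
  rfl

/-- **The phantom map is injective.** [cite: HatcherAT2002, §3.F Thm. 3F.8] -/
theorem phantomMap_injective (k : ℕ) : Injective (phantomMap R M hVo hmono hV k) := by
  intro a b h
  apply milnorInj_injective (exhCx R M hmono) (exhρ R M hmono) (exhρ_surjective R M hmono) k
  have h' := congrArg (HomologicalComplex.homologyMap (toLim R M hmono) (k + 1)) h
  rwa [phantomMap_apply, phantomMap_apply, homologyMap_toLim_inv, homologyMap_toLim_inv] at h'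

/-- **Exactness: phantom classes restrict to zero on every `Xₙ`.** [cite: HatcherAT2002, §3.F Thm. 3F.8] -/
theorem restrictionsLim_phantomMap (k : ℕ) (q : towerLim1 (M := exhH R M hmono k) (exhρH R M hmono k)) :
    restrictionsLim R M hmono (k + 1) (phantomMap R M hVo hmono hV k q) = 0 := by
  rw [phantomMap_apply]
  change milnorSurj _ _ (k + 1) (HomologicalComplex.homologyMap (toLim R M hmono) (k + 1)
    (HomologicalComplex.homologyMap (toLimIso R M hVo hmono hV).inv (k + 1) _)) = 0
  rw [homologyMap_toLim_inv]
  exact milnorSurj_milnorInj _ _ _ k q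

/-- **Exactness: a class restricting to zero on every `Xₙ` is a phantom class.** [cite: HatcherAT2002, §3.F Thm. 3F.8] -/
theorem exists_phantomMap_eq (k : ℕ) (x : singularCohomology R M X (k + 1))
    (hx : restrictionsLim R M hmono (k + 1) x = 0) : ∃ q, phantomMap R M hVo hmono hV k q = x := by
  obtain ⟨q, hq⟩ := exists_milnorInj_eq_of_milnorSurj_eq_zero (exhCx R M hmono) (exhρ R M hmono)
    (exhρ_surjective R M hmono) k (HomologicalComplex.homologyMap (toLim R M hmono) (k + 1) x) hx
  refine ⟨q, ?_⟩
  rw [phantomMap_apply, hq, homologyMap_inv_toLim]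

/-- A class vanishing on every `Xₙ` has `restrictionsLim = 0`. [folklore] -/
theorem restrictionsLim_eq_zero_iff (k : ℕ) (x : singularCohomology R M X k) :
    restrictionsLim R M hmono k x = 0 ↔ ∀ n, singularCohomology.map R M (subsetIncl (V n)) k x = 0 := by
  constructor
  · intro h n
    rw [← restrictionsLim_apply_coe R M hmono k x n, h]
    rfl
  · intro h
    exact Subtype.ext (funext fun n ↦ (restrictionsLim_apply_coe R M hmono k x n).trans (h n))

/-! ### The explicit cochain description of the phantom map -/

/-- The coboundaries of a solution `θ` of `θₙ - θₙ₊₁| = ηₙ` (`ηₙ` cocycles) form an exactly compatible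
family. [folklore] -/
theorem d_solution_compatible {k : ℕ} (η θ : ∀ n, (singularCochainComplex R M ↥(V n)).X k)
    (hη : ∀ n, (singularCochainComplex R M ↥(V n)).d k (k + 1) (η n) = 0)
    (hθ : ∀ n, θ n - (exhρ R M hmono n).f k (θ (n + 1)) = η n) (n : ℕ) :
    (singularCochainComplex.map R M (ContinuousMap.inclusion (hmono (Nat.le_succ n)))).f (k + 1)
        ((singularCochainComplex R M ↥(V (n + 1))).d k (k + 1) (θ (n + 1))) =
      (singularCochainComplex R M ↥(V n)).d k (k + 1) (θ n) := by
  have h := congrArg ((singularCochainComplex R M ↥(V n)).d k (k + 1)) (hθ n)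
  rw [map_sub, hη n, sub_eq_zero] at h
  rw [h]
  exact ρ_d_apply (exhCx R M hmono) (exhρ R M hmono) k (k + 1) n (θ (n + 1))

/-- The glued coboundaries form a cocycle of `X`. [folklore] -/
theorem d_glue_solution_eq_zero {k : ℕ} (η θ : ∀ n, (singularCochainComplex R M ↥(V n)).X k)
    (hη : ∀ n, (singularCochainComplex R M ↥(V n)).d k (k + 1) (η n) = 0)
    (hθ : ∀ n, θ n - (exhρ R M hmono n).f k (θ (n + 1)) = η n) :
    (singularCochainComplex R M X).d (k + 1) ((ComplexShape.up ℕ).next (k + 1))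
      (glueSeq (R := R) hVo hmono hV fun n ↦ (singularCochainComplex R M ↥(V n)).d k (k + 1) (θ n)) = 0 :=
  d_glueSeq_eq_zero hVo hmono hV _ (d_solution_compatible R M hmono η θ hη hθ) fun n ↦ by
    rw [← ModuleCat.comp_apply, HomologicalComplex.d_comp_d]
    rfl

/-- **The phantom map on cochains**: for cocycles `ηₙ ∈ Zᵏ(Xₙ)` and cochains `θₙ ∈ Cᵏ(Xₙ)` with
`θₙ - θₙ₊₁|Xₙ = ηₙ`, the phantom class of `[(ηₙ)ₙ]` is the class of the global cocycle glued from the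
compatible family `(dθₙ)ₙ` (the connecting map of `0 → C*(X) → Π C*(Xₙ) → Π C*(Xₙ) → 0`).
[cite: HatcherAT2002, §3.F Thm. 3F.8 (proof)] -/
theorem phantomMap_mk_eq {k : ℕ} (η θ : ∀ n, (singularCochainComplex R M ↥(V n)).X k)
    (hη : ∀ n, (singularCochainComplex R M ↥(V n)).d k (k + 1) (η n) = 0)
    (hθ : ∀ n, θ n - (exhρ R M hmono n).f k (θ (n + 1)) = η n) :
    phantomMap R M hVo hmono hV k (Submodule.Quotient.mk fun n ↦
        homologyCls (K := singularCochainComplex R M ↥(V n)) (η n) (by rw [CochainComplex.next]; exact hη n)) =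
      homologyCls (glueSeq (R := R) hVo hmono hV fun n ↦ (singularCochainComplex R M ↥(V n)).d k (k + 1) (θ n))
        (d_glue_solution_eq_zero R M hVo hmono hV η θ hη hθ) := by
  -- the product cocycle `η` and its class
  have hηp : (piCx (exhCx R M hmono)).d k ((ComplexShape.up ℕ).next k) η = 0 := by
    rw [CochainComplex.next]
    exact funext fun n ↦ hη n
  have hfam : (fun n ↦ homologyCls (K := singularCochainComplex R M ↥(V n)) (η n) (by rw [CochainComplex.next]; exact hη n)) =
      piHomologyMap (exhCx R M hmono) k (homologyCls (K := piCx (exhCx R M hmono)) η hηp) :=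
    funext fun n ↦ (piHomologyMap_homologyCls (exhCx R M hmono) k η hηp n).symm
  rw [hfam, phantomMap_apply, milnorInj_mk]
  -- the connecting map on representatives
  set x₁ : limX (exhCx R M hmono) (exhρ R M hmono) (k + 1) :=
    ⟨fun n ↦ (singularCochainComplex R M ↥(V n)).d k (k + 1) (θ n),
      (mem_towerLim_iff (M := XTower (exhCx R M hmono) (k + 1)) _ _).2 fun n ↦
        d_solution_compatible R M hmono η θ hη hθ n⟩ with hx₁
  have hx₁d : (limCx (exhCx R M hmono) (exhρ R M hmono)).d (k + 1) (k + 1 + 1) x₁ = 0 := by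
    apply Subtype.ext
    funext n
    change (singularCochainComplex R M ↥(V n)).d (k + 1) (k + 1 + 1) ((singularCochainComplex R M ↥(V n)).d k (k + 1) (θ n)) = 0
    rw [← ModuleCat.comp_apply, HomologicalComplex.d_comp_d]
    rfl
  have hx₁d' : (limCx (exhCx R M hmono) (exhρ R M hmono)).d (k + 1) ((ComplexShape.up ℕ).next (k + 1)) x₁ = 0 := by
    rw [CochainComplex.next]
    exact hx₁d
  have hδ : milnorδ (exhCx R M hmono) (exhρ R M hmono) (exhρ_surjective R M hmono) k
      (homologyCls (K := piCx (exhCx R M hmono)) η hηp) =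
        homologyCls (K := limCx (exhCx R M hmono) (exhρ R M hmono)) x₁ hx₁d' := by
    have hηk : (piCx (exhCx R M hmono)).d k (k + 1) η = 0 := funext fun n ↦ hη n
    rw [homologyCls_eq_homologyπ_cyclesMk (K := piCx (exhCx R M hmono)) η hηp (k + 1) (CochainComplex.next ℕ k) hηk,
      homologyCls_eq_homologyπ_cyclesMk (K := limCx (exhCx R M hmono) (exhρ R M hmono)) x₁ hx₁d' (k + 1 + 1)
        (CochainComplex.next ℕ (k + 1)) hx₁d]
    exact (milnorSC_shortExact (exhCx R M hmono) (exhρ R M hmono) (exhρ_surjective R M hmono)).δ_apply k (k + 1)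
      (crel_up k) η hηk θ (funext fun n ↦ hθ n) x₁ rfl (k + 1 + 1) (CochainComplex.next ℕ (k + 1))
  rw [hδ]
  -- `x₁ = toLim Θ`
  have hΘ : (toLim R M hmono).f (k + 1)
      (glueSeq (R := R) hVo hmono hV fun n ↦ (singularCochainComplex R M ↥(V n)).d k (k + 1) (θ n)) = x₁ :=
    Subtype.ext (funext fun n ↦ map_subsetIncl_glueSeq hVo hmono hV _ (d_solution_compatible R M hmono η θ hη hθ) n)
  have hcls : homologyCls (K := limCx (exhCx R M hmono) (exhρ R M hmono)) x₁ hx₁d' =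
      HomologicalComplex.homologyMap (toLim R M hmono) (k + 1)
        (homologyCls (glueSeq (R := R) hVo hmono hV fun n ↦ (singularCochainComplex R M ↥(V n)).d k (k + 1) (θ n))
          (d_glue_solution_eq_zero R M hVo hmono hV η θ hη hθ)) := by
    rw [homologyMap_homologyCls]
    simp_rw [hΘ]
  rw [hcls, homologyMap_inv_toLim]

end Literature.AlgebraicTopology.SingularHomology
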